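import Mathlib
import Summits.MatrixMultiplication.MatrixMultiplication.Theorems.FourierTwoFamiliesModPPrimeCyclicPowerGainThetaCliqueCover

/-!
# Cross-sum clique cover for theta-body kernels (`stub_thetaCrossSumBound`)

Crux/support item `stmt-MatrixMultiplication-14309` (`FourierTwoFamiliesModP.PrimeCyclicPowerGain`), line
`clique-coclique-direct-sum-clique`; closes the registered milestone stub `stub_thetaCrossSumBound`
(milestone 7 of the bet `stub_thetaBound`: "coherent shapes have nearly disjoint cross sums").

Setting: a finite additive commutative group `G`, vertices `v = (v.1, v.2) ∈ Finset G × Finset G` ("block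
pairs"), a frozen difference set `X₀`, and a kernel `B` that is symmetric, positive semidefinite as a real quadratic
form, entrywise nonnegative, and supported on pairs of ADMISSIBLE vertices (`|v.1| = |v.2| = s`, clause (W),
`v.1 − v.2 ⊆ X₀`) that are equal or COMPATIBLE (both cross-difference sets avoid `X₀`).  Suppose every two vertices
`v, w` of the diagonal support have cross-sum intersection `|(v.1 + w.2) ∩ (w.1 + v.2)| ≥ m`.  Then
`m² · Σ_{v,w} B v w ≤ |G| · s² · Σ_v B v v` (`sq_mul_value_le_of_crossSum`, `stub_thetaCrossSumBound`).

Proof (the line card's, via the landed fractional clique-cover bound `CliqueCover.value_le_of_cliqueCover`).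
For a support vertex `u` and `x : G` let `C (u, x) := {w : x ∈ (w.1 + u.2) ∩ (u.1 + w.2)}`.  It is a clique in the
kernel sense (`entry_eq_zero_of_crossSum`): if `w ≠ w'` lie in it, write `x = a + b₂ = a₁ + b'` with `a ∈ w.1`,
`b₂ ∈ u.2`, `a₁ ∈ u.1`, `b' ∈ w'.2`; then `a − b' = a₁ − b₂ ∈ (w.1 − w'.2) ∩ (u.1 − u.2) ⊆ (w.1 − w'.2) ∩ X₀`, so
`w, w'` are not compatible and `B w w' = 0`.  A support vertex `w` lies in `C (u, x)` for exactly
`|(w.1 + u.2) ∩ (u.1 + w.2)| ∈ [m, s²]` values of `x` (`≤ |w.1 + u.2| ≤ s²`); with weight `1/(m·K)` on each of the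
`K·|G|` cliques (`K` = size of the diagonal support) every support vertex is covered with multiplicity in
`[1, s²/m]`, and the clique-cover bound gives `Σ B ≤ (s²/m) · (|G|/m) · tr B`.  (`m = 0` and `K = 0` are trivial.)
-/

-- `Summit.<Summit>.<Problem>` coincide for this single-problem summit: the duplicate is deliberate.
set_option linter.dupNamespace false

namespace Summit.MatrixMultiplication.MatrixMultiplication.Theorems.PrimeCyclicPowerGainTheta.CrossSum

open scoped BigOperators Pointwise
open Summit.MatrixMultiplication.MatrixMultiplication.Theorems.PrimeCyclicPowerGainTheta

variable {G : Type*} [AddCommGroup G] [Fintype G] [DecidableEq G]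

omit [Fintype G] in
/-- **Cross-sum cliques.**  If `u.1 − u.2 ⊆ X₀` and the nonzero entries of `B` sit on equal-or-compatible pairs,
then `B w w' = 0` for two DISTINCT vertices `w, w'` with `x ∈ w.1 + u.2` and `x ∈ u.1 + w'.2`. -/
theorem entry_eq_zero_of_crossSum (X₀ : Finset G) (B : Finset G × Finset G → Finset G × Finset G → ℝ)
    (hsupp : ∀ v w : Finset G × Finset G, B v w ≠ 0 →
      v = w ∨ (Disjoint (v.1 - w.2) X₀ ∧ Disjoint (w.1 - v.2) X₀))
    (u : Finset G × Finset G) (hu : u.1 - u.2 ⊆ X₀) (x : G)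
    (w w' : Finset G × Finset G) (hww' : w ≠ w') (hw : x ∈ w.1 + u.2) (hw' : x ∈ u.1 + w'.2) :
    B w w' = 0 := by
  by_contra hB
  rcases hsupp w w' hB with h | ⟨hdis, _⟩
  · exact hww' h
  · rw [Finset.mem_add] at hw hw'
    obtain ⟨a, ha, b₂, hb₂, hab⟩ := hw
    obtain ⟨a₁, ha₁, b', hb', hab'⟩ := hw'
    have hmem : a - b' ∈ w.1 - w'.2 := Finset.sub_mem_sub ha hb'
    have hX : a - b' ∈ X₀ := by
      have e : a - b' = a₁ - b₂ := by
        rw [sub_eq_sub_iff_add_eq_add, hab, hab']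
      rw [e]
      exact hu (Finset.sub_mem_sub ha₁ hb₂)
    exact Finset.disjoint_left.1 hdis hmem hX

/-- **Cross-sum clique cover** (named-hypothesis form of `stub_thetaCrossSumBound`).  `B` symmetric, PSD,
entrywise nonnegative, supported on admissible equal-or-compatible pairs; if every two support vertices have
cross-sum intersection of size `≥ m`, then `m² · Σ_{v,w} B v w ≤ |G| · s² · Σ_v B v v`. -/
theorem sq_mul_value_le_of_crossSum (s m : ℕ) (X₀ : Finset G)
    (B : Finset G × Finset G → Finset G × Finset G → ℝ)
    (hsymm : ∀ v w, B v w = B w v)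
    (hpsd : ∀ x : Finset G × Finset G → ℝ, 0 ≤ ∑ v, ∑ w, x v * B v w * x w)
    (hnn : ∀ v w, 0 ≤ B v w)
    (hsupp : ∀ v w : Finset G × Finset G, B v w ≠ 0 →
      (v.1.card = s ∧ v.2.card = s ∧
        (∀ a ∈ v.1, ∀ a' ∈ v.1, ∀ b ∈ v.2, ∀ b' ∈ v.2, (a - a') + (b - b') = 0 → a = a' ∧ b = b') ∧
        v.1 - v.2 ⊆ X₀) ∧
      (w.1.card = s ∧ w.2.card = s ∧
        (∀ a ∈ w.1, ∀ a' ∈ w.1, ∀ b ∈ w.2, ∀ b' ∈ w.2, (a - a') + (b - b') = 0 → a = a' ∧ b = b') ∧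
        w.1 - w.2 ⊆ X₀) ∧
      (v = w ∨ (Disjoint (v.1 - w.2) X₀ ∧ Disjoint (w.1 - v.2) X₀)))
    (hcross : ∀ v w : Finset G × Finset G, B v v ≠ 0 → B w w ≠ 0 →
      m ≤ ((v.1 + w.2) ∩ (w.1 + v.2)).card) :
    (m : ℝ) ^ 2 * ∑ v, ∑ w, B v w ≤ (Fintype.card G : ℝ) * (s : ℝ) ^ 2 * ∑ v, B v v := by
  -- the trace is nonnegative
  have htr : 0 ≤ ∑ v, B v v :=
    Finset.sum_nonneg fun v _ => Kernel.diag_nonneg_of_psd B hpsd v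
  have hRHS : 0 ≤ (Fintype.card G : ℝ) * (s : ℝ) ^ 2 * ∑ v, B v v := by positivity
  -- trivial case `m = 0`
  rcases Nat.eq_zero_or_pos m with hm0 | hmpos
  · subst hm0
    simpa using hRHS
  -- the diagonal support and its size `K`
  set supp : Finset (Finset G × Finset G) := Finset.univ.filter fun u => B u u ≠ 0 with hsuppdef
  have hmem_supp : ∀ u, u ∈ supp ↔ B u u ≠ 0 := fun u => by
    simp only [hsuppdef, Finset.mem_filter, Finset.mem_univ, true_and]
  set K : ℕ := supp.card with hK
  -- trivial case `K = 0`: the kernel vanishes identically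
  rcases Nat.eq_zero_or_pos K with hK0 | hKpos
  · have hdiag : ∀ v, B v v = 0 := by
      intro v
      by_contra hv
      have : v ∈ supp := (hmem_supp v).2 hv
      rw [Finset.card_eq_zero.1 (hK ▸ hK0 : supp.card = 0)] at this
      simp at this
    have hzero : ∑ v, ∑ w, B v w = 0 :=
      Finset.sum_eq_zero fun v _ => Finset.sum_eq_zero fun w _ =>
        Orbit.entry_eq_zero_of_diag_eq_zero B hsymm hpsd v w (hdiag v)
    rw [hzero, mul_zero]
    exact hRHS
  -- positivity of the parameters
  have hmR : (0 : ℝ) < m := Nat.cast_pos.2 hmpos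
  have hKR : (0 : ℝ) < K := Nat.cast_pos.2 hKpos
  set c : ℝ := 1 / ((m : ℝ) * K) with hc
  have hcpos : 0 < c := by rw [hc]; positivity
  -- the cross-sum cliques, indexed by `(u, x)`, and their weights
  set C : (Finset G × Finset G) × G → Finset (Finset G × Finset G) := fun i =>
    Finset.univ.filter fun w => B i.1 i.1 ≠ 0 ∧ i.2 ∈ (w.1 + i.1.2) ∩ (i.1.1 + w.2) with hC
  set y : (Finset G × Finset G) × G → ℝ := fun i => if B i.1 i.1 ≠ 0 then c else 0 with hy
  have hmemC : ∀ i w, w ∈ C i ↔ B i.1 i.1 ≠ 0 ∧ i.2 ∈ (w.1 + i.1.2) ∩ (i.1.1 + w.2) := by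
    intro i w
    simp only [hC, Finset.mem_filter, Finset.mem_univ, true_and]
  have hy0 : ∀ i, 0 ≤ y i := fun i => by
    simp only [hy]
    split_ifs
    · exact hcpos.le
    · exact le_rfl
  -- each `C (u, x)` is a clique
  have hclique : ∀ i, ∀ v ∈ C i, ∀ w ∈ C i, v ≠ w → B v w = 0 := by
    rintro ⟨u, x⟩ v hv w hw hvw
    rw [hmemC] at hv hw
    obtain ⟨hu, hvx⟩ := hv
    obtain ⟨-, hwx⟩ := hw
    rw [Finset.mem_inter] at hvx hwx
    have huX : u.1 - u.2 ⊆ X₀ := (hsupp u u hu).1.2.2.2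
    exact entry_eq_zero_of_crossSum X₀ B (fun v w h => (hsupp v w h).2.2) u huX x v w hvw hvx.1 hwx.2
  -- the cover multiplicity of a vertex `w`: `c · Σ_{u ∈ supp} |(w.1 + u.2) ∩ (u.1 + w.2)|`
  have hY : ∀ w : Finset G × Finset G,
      (∑ i, if w ∈ C i then y i else 0) = c * ∑ u ∈ supp, (((w.1 + u.2) ∩ (u.1 + w.2)).card : ℝ) := by
    intro w
    rw [Fintype.sum_prod_type, Finset.mul_sum, Finset.sum_filter]
    refine Finset.sum_congr rfl fun u _ => ?_
    by_cases hu : B u u ≠ 0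
    · rw [if_pos hu]
      have e : ∀ x : G, (if w ∈ C (u, x) then y (u, x) else 0) =
          if x ∈ (w.1 + u.2) ∩ (u.1 + w.2) then c else 0 := by
        intro x
        have h1 : w ∈ C (u, x) ↔ x ∈ (w.1 + u.2) ∩ (u.1 + w.2) := by
          rw [hmemC]; exact ⟨fun h => h.2, fun h => ⟨hu, h⟩⟩
        have h2 : y (u, x) = c := by simp only [hy]; rw [if_pos hu]
        by_cases hx : x ∈ (w.1 + u.2) ∩ (u.1 + w.2)
        · rw [if_pos (h1.2 hx), if_pos hx, h2]
        · rw [if_neg (fun h => hx (h1.1 h)), if_neg hx]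
      simp_rw [e]
      rw [Finset.sum_ite_mem, Finset.univ_inter, Finset.sum_const, nsmul_eq_mul, mul_comm]
    · rw [if_neg hu]
      refine Finset.sum_eq_zero fun x _ => ?_
      rw [if_neg]
      rw [hmemC]
      exact fun h => hu h.1
  -- bounds on the cover multiplicity on the support
  have hcov : ∀ w, B w w ≠ 0 → 1 ≤ ∑ i, if w ∈ C i then y i else 0 := by
    intro w hw
    rw [hY w]
    have hle : ((m : ℝ) * K) ≤ ∑ u ∈ supp, (((w.1 + u.2) ∩ (u.1 + w.2)).card : ℝ) := by
      have h1 : ∑ _u ∈ supp, (m : ℝ) ≤ ∑ u ∈ supp, (((w.1 + u.2) ∩ (u.1 + w.2)).card : ℝ) :=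
        Finset.sum_le_sum fun u hu => by exact_mod_cast hcross w u hw ((hmem_supp u).1 hu)
      rw [Finset.sum_const, nsmul_eq_mul] at h1
      linarith
    calc (1 : ℝ) = c * ((m : ℝ) * K) := by rw [hc]; field_simp
      _ ≤ c * ∑ u ∈ supp, (((w.1 + u.2) ∩ (u.1 + w.2)).card : ℝ) :=
          mul_le_mul_of_nonneg_left hle hcpos.le
  have hmult : ∀ w, B w w ≠ 0 → (∑ i, if w ∈ C i then y i else 0) ≤ (s : ℝ) ^ 2 / m := by
    intro w hw
    rw [hY w]
    have hle : ∑ u ∈ supp, (((w.1 + u.2) ∩ (u.1 + w.2)).card : ℝ) ≤ (s : ℝ) ^ 2 * K := by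
      have h1 : ∑ u ∈ supp, (((w.1 + u.2) ∩ (u.1 + w.2)).card : ℝ) ≤ ∑ _u ∈ supp, (s : ℝ) ^ 2 := by
        refine Finset.sum_le_sum fun u hu => ?_
        have hu' : B u u ≠ 0 := (hmem_supp u).1 hu
        have hw1 : w.1.card = s := (hsupp w w hw).1.1
        have hu2 : u.2.card = s := (hsupp u u hu').1.2.1
        have h2 : ((w.1 + u.2) ∩ (u.1 + w.2)).card ≤ s ^ 2 :=
          calc ((w.1 + u.2) ∩ (u.1 + w.2)).card ≤ (w.1 + u.2).card := Finset.card_le_card Finset.inter_subset_left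
            _ ≤ w.1.card * u.2.card := Finset.card_add_le
            _ = s ^ 2 := by rw [hw1, hu2, sq]
        exact_mod_cast h2
      rw [Finset.sum_const, nsmul_eq_mul] at h1
      linarith
    calc c * ∑ u ∈ supp, (((w.1 + u.2) ∩ (u.1 + w.2)).card : ℝ) ≤ c * ((s : ℝ) ^ 2 * K) :=
          mul_le_mul_of_nonneg_left hle hcpos.le
      _ = (s : ℝ) ^ 2 / m := by rw [hc]; field_simp
  -- total weight `Σ y = K · |G| · c = |G| / m`
  have hysum : ∑ i, y i = (Fintype.card G : ℝ) / m := by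
    rw [Fintype.sum_prod_type]
    have e : ∀ u : Finset G × Finset G, (∑ _x : G, y (u, _x)) =
        if B u u ≠ 0 then (Fintype.card G : ℝ) * c else 0 := by
      intro u
      simp only [hy]
      split_ifs with hu
      · rw [Finset.sum_const, Finset.card_univ, nsmul_eq_mul]
      · rw [Finset.sum_const_zero]
    simp_rw [e]
    rw [← Finset.sum_filter, Finset.sum_const]
    change K • ((Fintype.card G : ℝ) * c) = _
    rw [nsmul_eq_mul, hc]
    field_simp
  -- the fractional clique-cover bound
  have key : ∑ v, ∑ w, B v w ≤ (s : ℝ) ^ 2 / m * (∑ i, y i) * ∑ v, B v v :=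
    CliqueCover.value_le_of_cliqueCover B C y ((s : ℝ) ^ 2 / m) hsymm hpsd hnn hy0 hclique hcov hmult
  rw [hysum] at key
  have e : (s : ℝ) ^ 2 / m * ((Fintype.card G : ℝ) / m) * ∑ v, B v v =
      (Fintype.card G : ℝ) * (s : ℝ) ^ 2 * (∑ v, B v v) / (m : ℝ) ^ 2 := by
    field_simp
  rw [e, le_div_iff₀ (pow_pos hmR 2)] at key
  linarith

/-- **Registered milestone stub `stub_thetaCrossSumBound`** (crux stmt-MatrixMultiplication-14309, line
clique-coclique-direct-sum-clique, milestone 7): cross-sum clique cover.  Finite abelian `G`, a symmetric PSD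
entrywise-nonnegative kernel with the bet's support hypothesis verbatim, and `m : ℕ` such that every two vertices of
the diagonal support have cross-sum intersection `|(v.1 + w.2) ∩ (w.1 + v.2)| ≥ m`.  Then
`m² · Σ B ≤ |G| · s² · tr B`. -/
theorem stub_thetaCrossSumBound :
    ∀ (G : Type) [AddCommGroup G] [Fintype G] [DecidableEq G] (s m : ℕ) (X₀ : Finset G)
      (B : Finset G × Finset G → Finset G × Finset G → ℝ),
      (∀ v w, B v w = B w v) →
      (∀ x : Finset G × Finset G → ℝ, 0 ≤ ∑ v, ∑ w, x v * B v w * x w) →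
      (∀ v w, 0 ≤ B v w) →
      (∀ v w : Finset G × Finset G, B v w ≠ 0 →
        (v.1.card = s ∧ v.2.card = s ∧
          (∀ a ∈ v.1, ∀ a' ∈ v.1, ∀ b ∈ v.2, ∀ b' ∈ v.2, (a - a') + (b - b') = 0 → a = a' ∧ b = b') ∧
          v.1 - v.2 ⊆ X₀) ∧
        (w.1.card = s ∧ w.2.card = s ∧
          (∀ a ∈ w.1, ∀ a' ∈ w.1, ∀ b ∈ w.2, ∀ b' ∈ w.2, (a - a') + (b - b') = 0 → a = a' ∧ b = b') ∧
          w.1 - w.2 ⊆ X₀) ∧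
        (v = w ∨ (Disjoint (v.1 - w.2) X₀ ∧ Disjoint (w.1 - v.2) X₀))) →
      (∀ v w : Finset G × Finset G, B v v ≠ 0 → B w w ≠ 0 → m ≤ ((v.1 + w.2) ∩ (w.1 + v.2)).card) →
      (m : ℝ) ^ 2 * ∑ v, ∑ w, B v w ≤ (Fintype.card G : ℝ) * (s : ℝ) ^ 2 * ∑ v, B v v :=
  fun _ _ _ _ s m X₀ B hsymm hpsd hnn hsupp hcross =>
    sq_mul_value_le_of_crossSum s m X₀ B hsymm hpsd hnn hsupp hcross

end Summit.MatrixMultiplication.MatrixMultiplication.Theorems.PrimeCyclicPowerGainTheta.CrossSum
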